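import Summits.AtomisticToContinuum.Crystallization.Theorems.HullExactificationCascadeRobustBarlowTemplateTransportSteps1
import Summits.AtomisticToContinuum.Crystallization.Theorems.HullExactificationCascadeRobustBarlowTemplateTransportSteps5
import Summits.AtomisticToContinuum.Crystallization.Theorems.PalmUnimodularRigidityShellsToBarlowChartTransportSteps6

/-!
# Line `registered` (crux `RobustBarlowTemplate`, stmt-AtomisticToContinuum-12088): the four in-layer transports `I, J, I⁻¹, J⁻¹` and the vertical transport `V` of frames read in scale-relative integer charts (specifications, inverse identities, apexes) (part 6: `J ∘ J⁻¹ = id`, apexes, polarity and one-sidedness at an apex)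

Helper lemmas for `develop_transport` (the geometric half of the line): frames `⟨x, t₁, t₂, U⟩`
read in the scale-relative integer charts `IsZChart` of an everywhere-good configuration with
reciprocal shells, their transports and the coherence of the resulting development `frameAt`.
The only metric inputs are the chart transfer lemma (`develop_transfer`, through
`transfer_nb_nb` / `transfer_nb_centre` of part 1) and `bond_nb_iff`; everything else is label
combinatorics in `ℤ³` (pattern facts `PalmUnimodularRigidityShellsToBarlowChartTransportPatterns*`
of the closed sibling crux `ShellsToBarlowChart`, stmt-9227, imported verbatim).  All `[folklore]`
(HalesDSP2012 §1.3 for the two kissing patterns).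

## Port notes
This file is the port of `PalmUnimodularRigidityShellsToBarlowChartTransportSteps6.lean`
(stmt-9227) to the SHELL relation of this crux, following verbatim the rules recorded in part 1
(`…RobustBarlowTemplateTransportSteps1`, "Port notes"):
* charts are `hch : ∀ z ∈ S, IsZChart S z (Pc z) (Ac z) (nb z)` (no scale family `ac`);
* the bond window `0 < dist a b ∧ dist a b ≤ 28/25` is replaced throughout by `b ∈ shell S a`
  (only inside proofs here: no statement of this part mentions a bond);
* `bond_symm h` becomes `hsy a ha b h` for the standing reciprocity hypothesis
  `hsy : ∀ x ∈ S, ∀ y ∈ shell S x, x ∈ shell S y`, threaded right after `hch` through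
  `Jstep_JinvStep`, `polar_at_apex`, `onesided_at_apex`;
* the two chart-agnostic pattern lemmas of the source part, `apexOf_eq_of_form` and
  `cap_label_polar_or_fcc`, are NOT re-proved (the gate forbids restating landed declarations):
  they are used from the 9227 file `…ShellsToBarlowChartTransportSteps6`, which is therefore
  imported here; since that import makes the 9227 parts 2–6 visible, the `open … hiding …` line of
  part 1 is EXTENDED by the 9227 names redeclared in our parts 2–6 (`Istep_spec`, `Jstep_spec`,
  `IinvStep_spec`, `JinvStep_spec`, `capWithAny_of_mem_cap`, `IinvStep_Istep`, `Istep_IinvStep`,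
  `JinvStep_Jstep`, `Jstep_JinvStep`, `polar_at_apex`, `onesided_at_apex`) — copy this longer
  line into every later part;
* theorem names, docstrings and the order of all other hypotheses are those of the source;
* `transportSteps6_anchor` (explicit-`∀` wrapper of `Jstep_JinvStep`) is the registered anchor of
  this file.
-/

noncomputable section

namespace Summit.AtomisticToContinuum.Crystallization.Theorems.HullExactificationCascadeRobustBarlowTemplate

open Literature.Geometry.DiscreteGeometry Literature.MathematicalPhysics.StatisticalMechanics
open Summit.AtomisticToContinuum.Crystallization.Theorems.PalmUnimodularRigidityShellsToBarlowChart hiding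
  IsZChart TransportSystem scales_tied sqNormInt_transfer bond_symm nb_mem zlab_spec zlab_nb bond_nb_iff
  pattern_cases transfer_nb_nb transfer_nb_centre transfer_nb_target sqNormInt_zlab_centre hcp_of_mirror_pair
  Istep_spec Jstep_spec IinvStep_spec JinvStep_spec capWithAny_of_mem_cap IinvStep_Istep Istep_IinvStep
  JinvStep_Jstep Jstep_JinvStep polar_at_apex onesided_at_apex

variable {S : Set (EuclideanSpace ℝ (Fin 3))} {Pc : (EuclideanSpace ℝ (Fin 3)) → Finset (Fin 3 → ℤ)}
  {Ac : (EuclideanSpace ℝ (Fin 3)) → ((EuclideanSpace ℝ (Fin 3)) →ₗᵢ[ℝ] (EuclideanSpace ℝ (Fin 3)))}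
  {nb : (EuclideanSpace ℝ (Fin 3)) → (Fin 3 → ℤ) → (EuclideanSpace ℝ (Fin 3))}

/-- **`J ∘ J⁻¹ = id`** on valid frames in the admissible regime. [folklore] -/
theorem Jstep_JinvStep (hch : ∀ z ∈ S, IsZChart S z (Pc z) (Ac z) (nb z))
    (hsy : ∀ x ∈ S, ∀ y ∈ shell S x, x ∈ shell S y) {x : (EuclideanSpace ℝ (Fin 3))} (hx : x ∈ S) {t₁ t₂ : Fin 3 → ℤ} {U : Finset (Fin 3 → ℤ)} (hU : IsFrame (Pc x) t₁ t₂ U) (hreg : Pc (nb x (-t₂)) = fcc3Int ∨ Pc x = hcpInt ∨ (-zlab Pc nb (nb x (-t₂)) x ∈ Pc (nb x (-t₂)) ∧ -zlab Pc nb (nb x (-t₂)) (nb x (t₁ - t₂)) ∈ Pc (nb x (-t₂)))) : Jstep Pc nb (JinvStep Pc nb ⟨x, t₁, t₂, U⟩) = ⟨x, t₁, t₂, U⟩ := by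
  obtain ⟨hyS, -, -, hwx, -, hvK, -, -, -, -, -, -, -, cm, hcmU, -, -, hbu, -, -, hfilt'⟩ :=
    JinvStep_spec hch hsy hx hU hreg
  have hUP : U ⊆ Pc x := hU.2.2.1
  have hnt₂ : -t₂ ∈ Pc x := hU.2.1 (mem_hexLabels_iff.2 (Or.inr (Or.inr (Or.inr (Or.inr (Or.inl rfl))))))
  have ht12 : t₁ - t₂ ∈ Pc x := hU.2.1 (mem_hexLabels_iff.2 (Or.inr (Or.inr (Or.inr (Or.inr (Or.inr rfl))))))
  have hμ := zlab_spec hch hyS (nb_mem hch hx (hUP hcmU)).1 hbu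
  set w := zlab Pc nb (nb x (-t₂)) x with hw_def
  set v := zlab Pc nb (nb x (-t₂)) (nb x (t₁ - t₂)) with hv_def
  set μ := zlab Pc nb (nb x (-t₂)) (nb x cm) with hμ_def
  set U' := (JinvStep Pc nb ⟨x, t₁, t₂, U⟩).U with hU'_def
  have hI : JinvStep Pc nb ⟨x, t₁, t₂, U⟩ = ⟨nb x (-t₂), v, w, U'⟩ := rfl
  have hf : U'.filter (fun e => sqNormInt (e - w) = 18) = {μ} := hfilt'
  rw [hI]
  simp only [Jstep]
  rw [hwx]
  rw [hf, Finset.image_singleton, hvK, hμ.2, zlab_nb hch hx hnt₂, zlab_nb hch hx ht12,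
    zlab_nb hch hx (hUP hcmU), neg_neg, show t₁ - t₂ - -t₂ = t₁ by abel,
    capWithAny_of_mem_cap hch hx hU hcmU]


/-! ## The vertical step -/

/-- **Polarity at the apex.**  If a site `u = nb x c` is attached to `x` through an upper-cap
label `c` of a valid frame at `x`, and `u` is HCP, then `x` is POLAR at `u` (the label of `x`
at `u` is not symmetric): otherwise the mirror pair touching that label would be two common
neighbours of `x, u` read at `x` at squared distance `48` around the cap label `c`.
[folklore] -/
theorem polar_at_apex (hch : ∀ z ∈ S, IsZChart S z (Pc z) (Ac z) (nb z))
    (hsy : ∀ x ∈ S, ∀ y ∈ shell S x, x ∈ shell S y) {x : (EuclideanSpace ℝ (Fin 3))} (hx : x ∈ S)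
    {t₁ t₂ : Fin 3 → ℤ} {U : Finset (Fin 3 → ℤ)} (hU : IsFrame (Pc x) t₁ t₂ U)
    {c : Fin 3 → ℤ} (hcU : c ∈ U) (hhcp : Pc (nb x c) = hcpInt) :
    -zlab Pc nb (nb x c) x ∉ Pc (nb x c) := by
  intro hneg
  have hcP : c ∈ Pc x := hU.2.2.1 hcU
  have hu := nb_mem hch hx hcP
  have hξ := zlab_spec hch hu.1 hx (hsy _ hx _ hu.2)
  set ξ := zlab Pc nb (nb x c) x with hξ_def
  have hξP : ξ ∈ hcpInt := by rw [← hhcp]; exact hξ.1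
  rw [hhcp] at hneg
  obtain ⟨m, hm, n, hn, hξm, hξn, hmn⟩ := exists_mirror_pair_of_equatorial ξ hξP hneg
  have hmP : m ∈ Pc (nb x c) := by rw [hhcp]; exact hm
  have hnP : n ∈ Pc (nb x c) := by rw [hhcp]; exact hn
  -- the two mirror neighbours are common neighbours of `x` and `u`
  have hzm := nb_mem hch hu.1 hmP
  have hzn := nb_mem hch hu.1 hnP
  have hbm : x ∈ shell S (nb (nb x c) m) := by
    have := (bond_nb_iff hch hu.1 hmP hξ.1).2 (by rw [sqNormInt_sub_comm]; exact hξm)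
    rwa [hξ.2] at this
  have hbn : x ∈ shell S (nb (nb x c) n) := by
    have := (bond_nb_iff hch hu.1 hnP hξ.1).2 (by rw [sqNormInt_sub_comm]; exact hξn)
    rwa [hξ.2] at this
  -- their labels at `x`
  have ha := zlab_spec hch hx hzm.1 (hsy _ hzm.1 _ hbm)
  have hb := zlab_spec hch hx hzn.1 (hsy _ hzn.1 _ hbn)
  set a := zlab Pc nb x (nb (nb x c) m) with ha_def
  set b := zlab Pc nb x (nb (nb x c) n) with hb_def
  -- both touch `c`
  have hac : sqNormInt (a - c) = 18 := by
    have := (bond_nb_iff hch hx ha.1 hcP).1 (by rw [ha.2]; exact hsy _ hu.1 _ hzm.2)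
    exact this
  have hbc : sqNormInt (b - c) = 18 := by
    have := (bond_nb_iff hch hx hb.1 hcP).1 (by rw [hb.2]; exact hsy _ hu.1 _ hzn.2)
    exact this
  -- transfer `x → u` of the pair: `48`
  have htr := transfer_nb_nb hch hsy hx hu.1 hu.2 ha.1 hb.1 (by rw [ha.2]; exact hzm.2)
    (by rw [hb.2]; exact hzn.2)
  rw [ha.2, hb.2, zlab_nb hch hu.1 hmP, zlab_nb hch hu.1 hnP, hmn] at htr
  exact no_48_around_polar (Pc x) (pattern_cases hch hx) c hcP a ha.1 b hb.1
    (cap_label_polar_or_fcc (pattern_cases hch hx) hU hcU)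
    (by rw [sqNormInt_sub_comm]; exact hac) (by rw [sqNormInt_sub_comm]; exact hbc) htr.symm

/-- **One-sidedness at a common apex.**  Two sites attached to the same site `u` through
upper-cap labels of valid frames are on one side at `u`: their labels at `u` are both symmetric
(FCC) or both polar (HCP). [folklore] -/
theorem onesided_at_apex (hch : ∀ z ∈ S, IsZChart S z (Pc z) (Ac z) (nb z))
    (hsy : ∀ x ∈ S, ∀ y ∈ shell S x, x ∈ shell S y) {x x' : (EuclideanSpace ℝ (Fin 3))}
    (hx : x ∈ S) (hx' : x' ∈ S) {t₁ t₂ t₁' t₂' : Fin 3 → ℤ} {U U' : Finset (Fin 3 → ℤ)}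
    (hU : IsFrame (Pc x) t₁ t₂ U) (hU' : IsFrame (Pc x') t₁' t₂' U') {c c' : Fin 3 → ℤ}
    (hcU : c ∈ U) (hcU' : c' ∈ U') (heq : nb x c = nb x' c') :
    (-zlab Pc nb (nb x c) x ∈ Pc (nb x c) ∧ -zlab Pc nb (nb x c) x' ∈ Pc (nb x c)) ∨
      (-zlab Pc nb (nb x c) x ∉ Pc (nb x c) ∧ -zlab Pc nb (nb x c) x' ∉ Pc (nb x c)) := by
  have hcP : c ∈ Pc x := hU.2.2.1 hcU
  have hcP' : c' ∈ Pc x' := hU'.2.2.1 hcU'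
  have hu := nb_mem hch hx hcP
  have hu' := nb_mem hch hx' hcP'
  have hξ := zlab_spec hch hu.1 hx (hsy _ hx _ hu.2)
  have hξ' := zlab_spec hch hu.1 hx' (by rw [heq]; exact hsy _ hx' _ hu'.2)
  rcases pattern_cases hch hu.1 with hF | hH
  · left
    rw [hF] at hξ hξ' ⊢
    exact ⟨neg_mem_fcc3Int _ hξ.1, neg_mem_fcc3Int _ hξ'.1⟩
  · right
    refine ⟨polar_at_apex hch hsy hx hU hcU hH, ?_⟩
    have := polar_at_apex hch hsy hx' hU' hcU' (by rw [← heq]; exact hH)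
    rwa [← heq] at this

/-! ## Anchor -/

/-- Anchor (registered sub-goal of stmt-AtomisticToContinuum-12088, toward `develop_transport`):
`J ∘ J⁻¹ = id` on valid frames in the admissible regime (explicit form of `Jstep_JinvStep`).
[folklore] -/
theorem transportSteps6_anchor : ∀ (S : Set (EuclideanSpace ℝ (Fin 3))) (Pc : EuclideanSpace ℝ (Fin 3) → Finset (Fin 3 → ℤ)) (Ac : EuclideanSpace ℝ (Fin 3) → (EuclideanSpace ℝ (Fin 3) →ₗᵢ[ℝ] EuclideanSpace ℝ (Fin 3))) (nb : EuclideanSpace ℝ (Fin 3) → (Fin 3 → ℤ) → EuclideanSpace ℝ (Fin 3)), (∀ z ∈ S, IsZChart S z (Pc z) (Ac z) (nb z)) → (∀ x ∈ S, ∀ y ∈ shell S x, x ∈ shell S y) → ∀ x ∈ S, ∀ (t₁ t₂ : Fin 3 → ℤ) (U : Finset (Fin 3 → ℤ)), IsFrame (Pc x) t₁ t₂ U → (Pc (nb x (-t₂)) = fcc3Int ∨ Pc x = hcpInt ∨ (-zlab Pc nb (nb x (-t₂)) x ∈ Pc (nb x (-t₂)) ∧ -zlab Pc nb (nb x (-t₂))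 (nb x (t₁ - t₂)) ∈ Pc (nb x (-t₂)))) → Jstep Pc nb (JinvStep Pc nb ⟨x, t₁, t₂, U⟩) = ⟨x, t₁, t₂, U⟩ :=
  fun _ _ _ _ hch hsy _ hx _ _ _ hU hreg => Jstep_JinvStep hch hsy hx hU hreg

end Summit.AtomisticToContinuum.Crystallization.Theorems.HullExactificationCascadeRobustBarlowTemplate

end
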